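import Summits.FinalStateConjecture.FinalStateConjecture.Theorems.SwallowTheDatumParametricKerrBurialLine
import Literature.Geometry.Lorentzian.InitialDataDilation
import Literature.Geometry.Lorentzian.AFEndDilationDecay
import Literature.Geometry.Lorentzian.KerrSliceDilation
import Literature.Geometry.Lorentzian.ChartSecondFundamentalFormDilation
import Literature.Geometry.Lorentzian.KerrSchildCoord
import Literature.Geometry.Lorentzian.LeviCivitaProofs

/-!
# Stub `stub_collarDilation` of the line `receding-annulus-universal-collar`
(crux `SwallowTheDatum.ParametricKerrBurial`, item stmt-FinalStateConjecture-10052)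

The universal collar `C` is dilated by every factor `l > 0`: `Cfam l := C.dilate l`
(`h'(y) = h(y/l)`, `k'(y) = l⁻¹ k(y/l)`). Admissibility, the Schwarzschild annulus (now of mass
`l μ` on `{l < ‖y‖ < 2l}`) and the located Kerr shield (parameters `(lM, la, l r₁)`, chart
`l · φ(·/l)`, graph of `T_{lM,la}`, the same normal vector) transport along the dilation.
-/

-- `Summit.<Summit>.<Problem>` is the tree's mandated summit-side namespace (CONVENTIONS §2); for this
-- single-conjunct summit the two coincide, so the duplicate is deliberate.
set_option linter.dupNamespace false

noncomputable section

-- instance search through the nested operator type `E3 →L[ℝ] E3 →L[ℝ] ℝ` (as in the tree files)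
set_option maxSynthPendingDepth 3

namespace Summit.FinalStateConjecture.FinalStateConjecture.Theorems.SwallowTheDatum.ParametricKerrBurial.CollarDilation

open scoped Manifold ContDiff Topology
open Bundle Set Filter Function Literature.Geometry.Lorentzian
open Summit.FinalStateConjecture.FinalStateConjecture.Theorems.KerrShieldedDataExist.Negative
  (bentHeight bentHeight_eq_literal blHeight)

/-! ### Scale covariance of the hard-coded bent height -/

/-- **Scale covariance of the hard-coded bent height**: `T_{lM, la}(l r) = l · T_{M,a}(r)` for
`l > 0`, `|a| < M`. [folklore] -/
theorem bentHeight_scale {l M a : ℝ} (hl : 0 < l) (haM : |a| < M) (r : ℝ) :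
    bentHeight (l * M) (l * a) (l * r) = l * bentHeight M a r := by
  -- adapted from `Cruxes/ParametricKerrBurial/Disproof.lean` §4 (`bentHeight_scale`)
  have hM : 0 < M := (abs_nonneg a).trans_lt haM
  have hs : Real.sqrt (M ^ 2 - a ^ 2) ≤ M := by
    rw [Real.sqrt_le_left hM.le]; nlinarith [sq_nonneg a]
  have hs0 : 0 ≤ Real.sqrt (M ^ 2 - a ^ 2) := Real.sqrt_nonneg _
  have hrp : Kerr.rPlus M a ≤ 2 * M := by unfold Kerr.rPlus; linarith
  have hrm : Kerr.rMinus M a ≤ 2 * M := (Kerr.rMinus_le_rPlus M a).trans hrp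
  have harg : l * r / (4 * (l * M)) - 1 = r / (4 * M) - 1 := by
    field_simp
  unfold bentHeight blHeight
  rw [harg, Kerr.rPlus_dilate hl.le, Kerr.rMinus_dilate hl.le, Kerr.sqrt_sq_sub_sq_dilate hl.le]
  rcases le_or_gt r (4 * M) with hr | hr
  · have : r / (4 * M) - 1 ≤ 0 := by
      rw [sub_nonpos, div_le_one (by positivity)]; exact hr
    rw [Real.smoothTransition.zero_of_nonpos this]; ring
  · have h1 : 0 < r - Kerr.rPlus M a := by linarith
    have h2 : 0 < r - Kerr.rMinus M a := by linarith
    have h3 : 0 < 4 * M - Kerr.rPlus M a := by linarith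
    have h4 : 0 < 4 * M - Kerr.rMinus M a := by linarith
    have e1 : l * r - l * Kerr.rPlus M a = l * (r - Kerr.rPlus M a) := by ring
    have e2 : l * r - l * Kerr.rMinus M a = l * (r - Kerr.rMinus M a) := by ring
    have e3 : 4 * (l * M) - l * Kerr.rPlus M a = l * (4 * M - Kerr.rPlus M a) := by ring
    have e4 : 4 * (l * M) - l * Kerr.rMinus M a = l * (4 * M - Kerr.rMinus M a) := by ring
    rw [e1, e2, e3, e4, Real.log_mul hl.ne' h1.ne', Real.log_mul hl.ne' h2.ne',
      Real.log_mul hl.ne' h3.ne', Real.log_mul hl.ne' h4.ne']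
    have hs' : Real.sqrt (M ^ 2 - a ^ 2) ≠ 0 :=
      (Real.sqrt_pos.2 (by nlinarith [abs_lt.1 haM])).ne'
    field_simp
    ring


/-! ### The dilated shield -/

section Shield

variable (l : ℝ) (hl : 0 < l) {a r₁ : ℝ}

/-- The dilated shielding chart `φ'(z) = l φ(z/l)`. [folklore] -/
def dilatePhi (φ : Kerr.slice a r₁ → E3) (z : Kerr.slice (l * a) (l * r₁)) : E3 :=
  l • φ (Kerr.sliceShrink l hl a r₁ z)

/-- The dilated bent-slice map `ψ'(z) = l ψ(z/l)`. [folklore] -/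
def dilatePsi (ψ : Kerr.slice a r₁ → Kerr.region a r₁) (z : Kerr.slice (l * a) (l * r₁)) :
    Kerr.region (l * a) (l * r₁) :=
  ⟨l • (ψ (Kerr.sliceShrink l hl a r₁ z) : E4), (Kerr.mem_region_dilate_iff hl).2 (ψ _).2⟩

/-- The dilated normal field `ν'(z) = ν(z/l)` (the SAME vector: the Kerr–Schild components are
dilation invariant). [folklore] -/
def dilateNu {ψ : Kerr.slice a r₁ → Kerr.region a r₁} (ν : NormalField 𝓘(ℝ, E4) ψ) :
    NormalField 𝓘(ℝ, E4) (dilatePsi l hl ψ) :=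
  fun z ↦ (ν (Kerr.sliceShrink l hl a r₁ z) : E4)

/-- Unfolding lemma for `dilatePhi`. [folklore] -/
theorem dilatePhi_apply (φ : Kerr.slice a r₁ → E3) (z : Kerr.slice (l * a) (l * r₁)) :
    dilatePhi l hl φ z = l • φ (Kerr.sliceShrink l hl a r₁ z) := rfl

/-- Unfolding lemma for `dilatePsi`. [folklore] -/
theorem coe_dilatePsi (ψ : Kerr.slice a r₁ → Kerr.region a r₁) (z : Kerr.slice (l * a) (l * r₁)) :
    (dilatePsi l hl ψ z : E4) = l • (ψ (Kerr.sliceShrink l hl a r₁ z) : E4) := rfl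

/-- Unfolding lemma for `dilateNu`. [folklore] -/
theorem dilateNu_apply {ψ : Kerr.slice a r₁ → Kerr.region a r₁} (ν : NormalField 𝓘(ℝ, E4) ψ)
    (z : Kerr.slice (l * a) (l * r₁)) :
    (dilateNu l hl ν z : E4) = ν (Kerr.sliceShrink l hl a r₁ z) := rfl

include hl in
/-- The components of the dilated Kerr metric are the original components read at `x'/l`.
[folklore] -/
theorem smoothMetric_val_eq_bilin_inv_smul [Kerr.Facts] (M : ℝ) (x' : Kerr.region (l * a) (l * r₁)) :
    (Kerr.smoothMetric (l * M) (l * a) (l * r₁)).val x' = Kerr.bilin M a (l⁻¹ • (x' : E4)) := by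
  rw [Kerr.smoothMetric_val]
  conv_lhs => rw [show (x' : E4) = l • (l⁻¹ • (x' : E4)) by
    rw [smul_smul, mul_inv_cancel₀ hl.ne', one_smul]]
  exact Kerr.bilin_dilate hl M a _

end Shield

/-- **The located shield transports under dilation**: `IsKerrShieldedAway ρ C` gives
`IsKerrShieldedAway (l ρ) (C.dilate l)` with parameters `(lM, la, l r₁)`, chart `l φ(·/l)`, graph of
`T_{lM,la}` and the same normal vector; the second fundamental forms match by the dilation
covariance `K' = l⁻¹ K` (`OpensChart.secondFundamentalForm_dilate`). [folklore] -/
theorem isKerrShieldedAway_dilate [Kerr.Facts] (C : InitialDataSet (𝓡 3) E3) {ρ l : ℝ}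
    (hl : 0 < l) (h : IsKerrShieldedAway ρ C) : IsKerrShieldedAway (l * ρ) (C.dilate l hl) := by
  obtain ⟨M, a, r₁, hM, T, φ, ψ, ν, hρ, haM, hrm, hrp, hT, hcpt, hemb, hφs, hψ, himm, hfun, hh, hk⟩ := h
  subst hT
  -- abbreviations and the transport data
  have hσ : ∀ z : Kerr.slice (l * a) (l * r₁), ((Kerr.sliceShrink l hl a r₁ z : Kerr.slice a r₁) : E3) =
      l⁻¹ • (z : E3) := Kerr.coe_sliceShrink hl
  have hf' : ∀ z, (dilatePsi l hl ψ z : E4) = l • (ψ (Kerr.sliceShrink l hl a r₁ z) : E4) :=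
    coe_dilatePsi l hl ψ
  have hφ' : ∀ z, dilatePhi l hl φ z = l • φ (Kerr.sliceShrink l hl a r₁ z) := dilatePhi_apply l hl φ
  have hν' : ∀ z, (dilateNu l hl ν z : E4) = ν (Kerr.sliceShrink l hl a r₁ z) := dilateNu_apply l hl ν
  have hψd : ∀ y, MDifferentiableAt 𝓘(ℝ, E3) 𝓘(ℝ, E4) ψ y := fun y ↦
    himm.contMDiff_self.mdifferentiableAt (by simp)
  have hφd : ∀ y, MDifferentiableAt 𝓘(ℝ, E3) (𝓡 3) φ y := fun y ↦ hφs.mdifferentiableAt (by simp)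
  have hdψ : ∀ (z : Kerr.slice (l * a) (l * r₁)) (v : E3),
      mfderiv 𝓘(ℝ, E3) 𝓘(ℝ, E4) (dilatePsi l hl ψ) z v =
        mfderiv 𝓘(ℝ, E3) 𝓘(ℝ, E4) ψ (Kerr.sliceShrink l hl a r₁ z) v := fun z v ↦
    OpensChart.mfderiv_dilate_apply hl hσ hf' (hψd _) v
  have hdφ : ∀ (z : Kerr.slice (l * a) (l * r₁)) (v : E3),
      mfderiv 𝓘(ℝ, E3) (𝓡 3) (dilatePhi l hl φ) z v =
        mfderiv 𝓘(ℝ, E3) (𝓡 3) φ (Kerr.sliceShrink l hl a r₁ z) v := fun z v ↦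
    OpensChart.mfderiv_dilate_apply' hl hσ hφ' (hφd _) v
  have hG : ∀ x : Kerr.region a r₁, (Kerr.smoothMetric M a r₁).val x = Kerr.bilin M a x :=
    Kerr.smoothMetric_val M a r₁
  have hG' : ∀ x' : Kerr.region (l * a) (l * r₁),
      (Kerr.smoothMetric (l * M) (l * a) (l * r₁)).val x' = Kerr.bilin M a (l⁻¹ • (x' : E4)) :=
    smoothMetric_val_eq_bilin_inv_smul l hl M
  have hbase : ∀ z, l⁻¹ • dilatePhi l hl φ z = φ (Kerr.sliceShrink l hl a r₁ z) := fun z ↦ by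
    rw [hφ', smul_smul, inv_mul_cancel₀ hl.ne', one_smul]
  refine ⟨l * M, l * a, l * r₁, mul_nonneg hl.le hM, bentHeight (l * M) (l * a), dilatePhi l hl φ,
    dilatePsi l hl ψ, dilateNu l hl ν, fun z ↦ ?_, ?_, ?_, ?_, rfl, ?_, ?_, ?_, fun z ↦ ?_, ?_, ?_,
    fun z ↦ ?_, fun z ↦ ?_⟩
  · -- located beyond `l ρ`
    rw [hφ', norm_smul, Real.norm_of_nonneg hl.le]
    exact mul_lt_mul_of_pos_left (hρ _) hl
  · rw [abs_mul, abs_of_pos hl]; exact mul_lt_mul_of_pos_left haM hl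
  · rw [Kerr.rMinus_dilate hl.le]; exact mul_lt_mul_of_pos_left hrm hl
  · rw [Kerr.rPlus_dilate hl.le]; exact mul_lt_mul_of_pos_left hrp hl
  · -- compact complement of the range
    have hr : range (dilatePhi l hl φ) = (Homeomorph.smulOfNeZero l hl.ne') '' range φ := by
      ext y
      constructor
      · rintro ⟨z, rfl⟩
        exact ⟨φ (Kerr.sliceShrink l hl a r₁ z), ⟨_, rfl⟩, rfl⟩
      · rintro ⟨_, ⟨y', rfl⟩, rfl⟩
        obtain ⟨z, hz⟩ := Kerr.sliceShrink_surjective hl a r₁ y'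
        exact ⟨z, by rw [hφ', hz]; rfl⟩
    rw [hr, ← image_compl_eq (Homeomorph.smulOfNeZero l hl.ne').bijective]
    exact hcpt.image (Homeomorph.smulOfNeZero l hl.ne').continuous
  · -- open embedding
    exact (Homeomorph.smulOfNeZero l hl.ne').isOpenEmbedding.comp
      (hemb.comp (Kerr.sliceShrinkHomeomorph l hl a r₁).isOpenEmbedding)
  · -- smooth chart
    exact ((l • ContinuousLinearMap.id ℝ E3).contDiff.contMDiff).comp
      (hφs.comp (Kerr.contMDiff_sliceShrink hl a r₁))
  · -- the graph of the dilated bent height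
    have hz : (z : E3) = l • ((Kerr.sliceShrink l hl a r₁ z : Kerr.slice a r₁) : E3) := by
      rw [hσ, smul_smul, mul_inv_cancel₀ hl.ne', one_smul]
    rw [hz, E4.ofTimeSpace_zero_smul, Kerr.radius_smul hl, bentHeight_scale hl haM,
      ← Kerr.smul_ofTimeSpace, ← hψ]
    rfl
  · -- spacelike immersion
    refine ⟨?_, fun z v hv ↦ ?_⟩
    · have hinf : ((∞ : ℕ∞ω) + 1) = ∞ := rfl
      rw [hinf]
      exact (ContMDiff.subtypeVal_comp_iff _ _).1
        (((l • ContinuousLinearMap.id ℝ E4).contDiff.contMDiff).comp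
          ((contMDiff_subtype_val.comp himm.contMDiff_self).comp (Kerr.contMDiff_sliceShrink hl a r₁)))
    · have hpos := himm.2 (Kerr.sliceShrink l hl a r₁ z) v hv
      rw [PseudoRiemannianMetric.inducedBilin_apply] at hpos ⊢
      rw [hdψ, hG']
      rw [hG] at hpos
      rw [hf', smul_smul, inv_mul_cancel₀ hl.ne', one_smul]
      exact hpos
  · -- future unit normal
    obtain ⟨⟨hn1, hn2⟩, hn3⟩ := hfun
    refine ⟨⟨fun z v ↦ ?_, fun z ↦ ?_⟩, fun z ↦ ?_⟩
    · have := hn1 (Kerr.sliceShrink l hl a r₁ z) v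
      rw [hG] at this
      rw [hdψ, hG', hf', smul_smul, inv_mul_cancel₀ hl.ne', one_smul]
      exact this
    · have := hn2 (Kerr.sliceShrink l hl a r₁ z)
      rw [hG] at this
      rw [hG', hf', smul_smul, inv_mul_cancel₀ hl.ne', one_smul]
      exact this
    · obtain ⟨⟨hc1, hc2⟩, hc3⟩ := hn3 (Kerr.sliceShrink l hl a r₁ z)
      refine ⟨⟨?_, hc2⟩, ?_⟩
      · change Kerr.bilin (l * M) (l * a) (l • (ψ (Kerr.sliceShrink l hl a r₁ z) : E4))
          (ν (Kerr.sliceShrink l hl a r₁ z)) (ν (Kerr.sliceShrink l hl a r₁ z)) ≤ 0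
        rw [Kerr.bilin_dilate hl]; exact hc1
      · change Kerr.bilin (l * M) (l * a) (l • (ψ (Kerr.sliceShrink l hl a r₁ z) : E4))
          (Kerr.timeVector (l * M) (l * a) (l • (ψ (Kerr.sliceShrink l hl a r₁ z) : E4)))
          (ν (Kerr.sliceShrink l hl a r₁ z)) < 0
        rw [Kerr.bilin_dilate hl, Kerr.timeVector_dilate hl]; exact hc3
  · -- the metric matches
    have key := hh (Kerr.sliceShrink l hl a r₁ z)
    ext v w
    have kvw : C.h.inner (φ (Kerr.sliceShrink l hl a r₁ z))
        (mfderiv 𝓘(ℝ, E3) (𝓡 3) φ (Kerr.sliceShrink l hl a r₁ z) v)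
        (mfderiv 𝓘(ℝ, E3) (𝓡 3) φ (Kerr.sliceShrink l hl a r₁ z) w) =
        (Kerr.smoothMetric M a r₁).val (ψ (Kerr.sliceShrink l hl a r₁ z))
          (mfderiv 𝓘(ℝ, E3) 𝓘(ℝ, E4) ψ (Kerr.sliceShrink l hl a r₁ z) v)
          (mfderiv 𝓘(ℝ, E3) 𝓘(ℝ, E4) ψ (Kerr.sliceShrink l hl a r₁ z) w) :=
      DFunLike.congr_fun (DFunLike.congr_fun key v) w
    change (C.dilate l hl).h.inner (dilatePhi l hl φ z)
        (mfderiv 𝓘(ℝ, E3) (𝓡 3) (dilatePhi l hl φ) z v)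
        (mfderiv 𝓘(ℝ, E3) (𝓡 3) (dilatePhi l hl φ) z w) =
      (Kerr.smoothMetric (l * M) (l * a) (l * r₁)).val (dilatePsi l hl ψ z)
        (mfderiv 𝓘(ℝ, E3) 𝓘(ℝ, E4) (dilatePsi l hl ψ) z v)
        (mfderiv 𝓘(ℝ, E3) 𝓘(ℝ, E4) (dilatePsi l hl ψ) z w)
    rw [hdφ, hdφ, hdψ, hdψ, hG', hf', smul_smul, inv_mul_cancel₀ hl.ne', one_smul]
    rw [hG] at kvw
    refine Eq.trans ?_ kvw
    rw [C.dilate_h_inner l hl, hbase]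
  · -- the second fundamental form matches: `K' = l⁻¹ K` on both sides
    haveI : (Kerr.smoothMetric M a r₁).HasLeviCivita := PseudoRiemannianMetric.hasLeviCivita _
    have key := hk (Kerr.sliceShrink l hl a r₁ z)
    have hsff := OpensChart.secondFundamentalForm_dilate (g := (Kerr.smoothMetric M a r₁).toPseudoRiemannianMetric)
      (g' := (Kerr.smoothMetric (l * M) (l * a) (l * r₁)).toPseudoRiemannianMetric)
      hl hσ hf' hG hG' hν' (hψd _) (Kerr.differentiableAt_bilin M a _) (z := z)
    refine LinearMap.ext fun v ↦ LinearMap.ext fun w ↦ ?_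
    have kvw : C.k (φ (Kerr.sliceShrink l hl a r₁ z)) (mfderiv 𝓘(ℝ, E3) (𝓡 3) φ _ v)
        (mfderiv 𝓘(ℝ, E3) (𝓡 3) φ _ w) =
        (Kerr.smoothMetric M a r₁).secondFundamentalForm 𝓘(ℝ, E3) ψ ν (Kerr.sliceShrink l hl a r₁ z) v w :=
      LinearMap.congr_fun₂ key v w
    have svw : (Kerr.smoothMetric (l * M) (l * a) (l * r₁)).secondFundamentalForm 𝓘(ℝ, E3)
        (dilatePsi l hl ψ) (dilateNu l hl ν) z v w =
        l⁻¹ * (Kerr.smoothMetric M a r₁).secondFundamentalForm 𝓘(ℝ, E3) ψ ν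
          (Kerr.sliceShrink l hl a r₁ z) v w :=
      LinearMap.congr_fun₂ hsff v w
    rw [svw, ← kvw]
    change (C.dilate l hl).k (dilatePhi l hl φ z) (mfderiv 𝓘(ℝ, E3) (𝓡 3) (dilatePhi l hl φ) z v)
        (mfderiv 𝓘(ℝ, E3) (𝓡 3) (dilatePhi l hl φ) z w) = _
    rw [hdφ, hdφ, C.dilate_k l hl, hbase]

/-! ### The stub -/

/-- **Stub `stub_collarDilation`** (line `receding-annulus-universal-collar`): the universal collar
dilated by every `l > 0` — `Cfam l = C.dilate l`, `h'(y) = h(y/l)`, `k'(y) = l⁻¹ k(y/l)` — is a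
jointly smooth family of admissible data, exactly Schwarzschild(`l μ`) with `k = 0` on
`{l < ‖y‖ < 2l}`, and Kerr-shielded by a chart ranging beyond radius `2l`. [folklore] -/
theorem stub_collarDilation : ∀ [Kerr.Facts] (C : InitialDataSet (𝓡 3) E3) (μ : ℝ), 0 < μ → C ∈ admissibleVacuumData E3 → IsSchwarzschildAnnulus C μ → IsKerrShieldedAway 2 C → ∃ Cfam : ℝ → InitialDataSet (𝓡 3) E3, SmoothSectionsOn 𝓘(ℝ, ℝ) Cfam {p : ℝ × E3 | 0 < p.1} ∧ ∀ l : ℝ, 0 < l → Cfam l ∈ admissibleVacuumData E3 ∧ (∀ y : E3, l < ‖y‖ → ‖y‖ < 2 * l → (Cfam l).h.inner y = (1 + l * μ / (2 * ‖y‖)) ^ 4 • (innerSL ℝ : E3 →L[ℝ] E3 →L[ℝ] ℝ) ∧ (Cfam l).k y = 0) ∧ IsKerrShieldedAway (2 * l) (Cfam l) := by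
  intro _ C μ _ hC hann hsh
  refine ⟨C.dilateFamily, ⟨fun p hp ↦ (C.contMDiffAt_dilateFamily_h hp).contMDiffWithinAt,
    fun p hp ↦ (C.contMDiffAt_dilateFamily_k hp).contMDiffWithinAt⟩, fun l hl ↦
    ⟨C.dilateFamily_mem_admissibleVacuumData l hl hC, fun y h1 h2 ↦ ?_, ?_⟩⟩
  · -- the dilated Schwarzschild annulus
    rw [C.dilateFamily_of_pos hl]
    have hny : ‖l⁻¹ • y‖ = l⁻¹ * ‖y‖ := by
      rw [norm_smul, Real.norm_of_nonneg (inv_nonneg.2 hl.le)]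
    have hy1 : 1 < ‖l⁻¹ • y‖ := by
      rw [hny, lt_inv_mul_iff₀ hl, mul_one]; exact h1
    have hy2 : ‖l⁻¹ • y‖ < 2 := by
      rw [hny, inv_mul_lt_iff₀ hl, mul_comm]; exact h2
    obtain ⟨hhy, hky⟩ := hann (l⁻¹ • y) hy1 hy2
    have hcoef : 1 + μ / (2 * ‖l⁻¹ • y‖) = 1 + l * μ / (2 * ‖y‖) := by
      rw [hny]; field_simp
    have hhy' : C.coordH (l⁻¹ • y) = (1 + μ / (2 * ‖l⁻¹ • y‖)) ^ 4 • (innerSL ℝ : E3 →L[ℝ] E3 →L[ℝ] ℝ) :=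
      hhy
    have hky' : C.coordK (l⁻¹ • y) = 0 := hky
    constructor
    · ext v w
      rw [C.dilate_h_inner l hl]
      change C.coordH (l⁻¹ • y) v w = _
      rw [hhy', hcoef]
      rfl
    · ext v w
      rw [C.dilate_k l hl]
      change l⁻¹ * C.coordK (l⁻¹ • y) v w = 0
      rw [hky']
      simp
  · -- the dilated shield, located beyond `2 l`
    rw [C.dilateFamily_of_pos hl, mul_comm]
    exact isKerrShieldedAway_dilate C hl hsh

end Summit.FinalStateConjecture.FinalStateConjecture.Theorems.SwallowTheDatum.ParametricKerrBurial.CollarDilation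

end
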